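import Summits.BirchSwinnertonDyer.BirchSwinnertonDyer.Theorems.GenusKolyvaginAtTwoGenusPrimitiveSupplyAtTwoTwistingPrimeDepthEntangled
import Summits.BirchSwinnertonDyer.BirchSwinnertonDyer.Theorems.GenusKolyvaginAtTwoGenusPrimitiveSupplyAtTwoTwistingPrimeDepthEntangledIff
import HarnessLib

/-!
# Route `GenusKolyvaginAtTwo`, crux #2 `GenusPrimitiveSupplyAtTwo` (stmt-BirchSwinnertonDyer-22136):
# THE DEPTH-`M` SUPPLY OF A `Sel₂`-TRIVIAL EVEN GENUS TWIST EXISTS **IFF** THE TWIN IS NOT ENTANGLED — one `iff`, modulo Poitou–Tate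
# duality and Tate's local Euler characteristic only

Width seat `bsd-line-gk2-p4` g9 (cell `bsd-f1-sign2`), eighteenth file of the twisting-prime series (crux workfile
`Lines/genus-supply-depth-class.md` §4). THEOREMS ONLY (no definition, no named fact, no `sorry`); helper
`--supports stmt-BirchSwinnertonDyer-22136`; no item is closed; BSD is not proved by any of this.

The headline of the g8/g9 depth analysis as ONE equivalence. Frame: `W/ℚ` globally minimal elliptic, `Δ_W < 0`, `ρ̄_{W,2}` onto, `K`
imaginary quadratic (the Heegner field of the crux), `Wd` a globally minimal model of a twist `W^{(d)}` (`d ≠ 0`; the LEVEL LAW's twin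
`A = E^{(d_K)}`) with `#Sel₂(Wd) = 2`, `M ≥ 1`. Then, granted the print facts `poitouTate_selmerStructure_duality_real ℚ` (Milne I.4.10) and
`localEulerPoincareCharacteristic` (Milne I.2.8):

  «SOME `2`-Selmer class of `Wd` does not die on `Γ_{ℚ(E[2^M])}`» (NOT ENTANGLED at level `2^M`)
  ⟺ «beyond every finite `B₀` there is a Kolyvagin prime `ℓ` for `(E, K, 2)` of DEPTH `M` (`FrobEqFrobInfty W K (2^M) ℓ`) with
     `8·N_W·N_{Wd} ∣ ℓ + 1` (so `ℚ(√−ℓ)` is a prime Heegner field for both conductors, `2` split) at which EVERY elliptic model of the even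
     genus twist `Wd^{(−ℓ)}` has `#Sel₂ = 1`»

(`exists_selmer_h1Eval_ne_iff_forall_exists_kolyvaginPrime_evenTwist_selmer_eq_one`; ⟹ = the SUPPLY: g8 Čebotarev (single-class form, p629671)
∘ gk2-p5 g8 Cor. 3.4 (i) DOWN p624297; ⟸ = the NECESSITY: p627529, unconditional), and its POINT-LEVEL form
(`exists_torsionFixing_smul_ne_iff_forall_exists_kolyvaginPrime_evenTwist_selmer_eq_one`: for `P ∈ Wd(ℚ) ∖ 2Wd(ℚ)` with half `Q`, «some
`h ∈ Γ_{ℚ(E[2^M])}` MOVES `Q`» ⟺ the same supply). At `M = 2` this is exactly the input «prime `ℓ` with `4 ∣ a_ℓ` + `Sel₂`-trivial even genus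
twist» of the lead's auxiliary-field form of U (p615396): **available iff the twin's generator is not halvable over `ℚ(E[4])`**.
The `W`-side class (g8's hypothesis `hS`) is NOT needed for the twin-side supply (single-class Čebotarev).

References: [MazurRubin2010] Def. 3.1, Prop. 3.3, Cor. 3.4 (i), Lemma 3.5; [GrossLMS1991] §3, §9 Prop. 9.6; [McCallumLMS1991] §3–§4;
[LawsonWuthrich2016] Lemma 6, Thm. 1; [MilneADT2006] I Thm. 2.8, 4.10.
-/

set_option linter.dupNamespace false -- tree convention: `Summit.BirchSwinnertonDyer.BirchSwinnertonDyer.Theorems` (summit = sub-problem)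
set_option autoImplicit false

noncomputable section

open scoped Classical Pointwise

namespace Summit.BirchSwinnertonDyer.BirchSwinnertonDyer.Theorems.GenusKolyTwistingPrime

open WeierstrassCurve NumberField IsDedekindDomain Field
open Literature.NumberTheory.GaloisRepresentations Literature.NumberTheory.EllipticCurves
open Literature.NumberTheory Literature.NumberTheory.GaloisCohomology

section DepthIff

variable (W : WeierstrassCurve ℚ) [W.IsElliptic] {K : Type} [Field K] [NumberField K]

/-- **THE TWIN-SIDE DEPTH-`M` SUPPLY, modulo {PT, Tate χ} and the twin's non-entanglement ONLY** (no `W`-side class, no `#Sel₂(W)`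
hypothesis): `W/ℚ` globally minimal, `Δ_W < 0`, `ρ̄_{W,2}` onto, `K` imaginary quadratic, `Wd` a globally minimal model of `W^{(d)}` with
`#Sel₂(Wd) = 2`, and SOME Selmer class of `Wd` not dying on `Γ_{ℚ(E[2^M])}` ⟹ beyond every `B₀` a Kolyvagin prime `ℓ` of depth `M` with
`8·N_W·N_{Wd} ∣ ℓ + 1` at which every elliptic model of `Wd^{(−ℓ)}` has `#Sel₂ = 1`. (Single-class Čebotarev p629671 + the prime Heegner
field `ℚ(√−ℓ)` of `Wd` + gk2-p5's DOWN `natCard_selmerGroup_eq_two_mul_of_not_le_strictLocalKer`.)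
[cite: MazurRubin2010, Cor. 3.4 (i), Lemma 3.5] [cite: GrossLMS1991, §3 (3.1)–(3.3)] [cite: MilneADT2006, I Thm. 2.8, 4.10] -/
theorem exists_kolyvaginPrime_pow_evenTwist_selmer_eq_one_of_duality
    (hPT : poitouTate_selmerStructure_duality_real ℚ)
    (hEP : ∀ v : HeightOneSpectrum (𝓞 ℚ), localEulerPoincareCharacteristic (v.adicCompletion ℚ))
    (hsurj : W.HasSurjectiveModNGaloisRep 2) (hΔ : W.Δ < 0) (hK : IsImaginaryQuadratic K)
    {d : ℚ} (hd : d ≠ 0) {Wd : WeierstrassCurve ℚ} [Wd.IsElliptic] [Wd.IsGloballyMinimal] {C : VariableChange ℚ}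
    (hWd : C • W.quadraticTwist d = Wd) (h2 : Nat.card (Wd.selmerGroup 2) = 2) {M : ℕ} (hM : 1 ≤ M)
    (hS' : ∃ c' ∈ Wd.selmerGroup 2, ∃ h ∈ torsionFixing W ((2 ^ M : ℕ) : ℤ), h1Eval Wd (2 : ℤ) c' h ≠ 0) (B₀ : Finset ℕ) :
    ∃ ℓ : ℕ, ∃ _ : Fact ℓ.Prime, ℓ ∉ B₀ ∧ 8 * W.conductorNorm ℤ * Wd.conductorNorm ℤ ∣ ℓ + 1 ∧
      IsKolyvaginPrime (W.conductorNorm ℤ) W K 2 ℓ ∧ FrobEqFrobInfty W K (2 ^ M) ℓ ∧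
      ∀ (W₂ : WeierstrassCurve ℚ) [W₂.IsElliptic],
        (∃ C₂ : VariableChange ℚ, C₂ • Wd.quadraticTwist (-(ℓ : ℚ)) = W₂) → Nat.card (W₂.selmerGroup 2) = 1 := by
  have hNW : W.conductorNorm ℤ ≠ 0 := (W.conductorNorm_pos_holds).ne'
  have hNWd : Wd.conductorNorm ℤ ≠ 0 := (Wd.conductorNorm_pos_holds).ne'
  have hm : 8 * W.conductorNorm ℤ * Wd.conductorNorm ℤ ≠ 0 := by positivity
  have hΔd : Wd.Δ < 0 := Δ_neg_of_smul_quadraticTwist' W hd hΔ hWd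
  obtain ⟨c', hc'S, hc'⟩ := hS'
  obtain ⟨ℓ, hℓF, hℓB₀, hmdvd, hKoly, hFrobM, hc'ℓ⟩ :=
    exists_kolyvaginPrime_pow_not_mem_torsionLocalKer_of_exists_h1Eval_ne W hsurj hΔ hK hM hd hWd hc' hm B₀
  have hℓ : ℓ.Prime := hℓF.out
  have hℓ8 : ℓ % 8 = 7 := by
    have h8 : 8 ∣ ℓ + 1 := (Dvd.intro _ rfl).trans ((Dvd.intro _ rfl).trans hmdvd)
    omega
  have hℓNd : ∀ p : ℕ, p.Prime → p ∣ Wd.conductorNorm ℤ → p ≠ 2 → (ℓ : ZMod p) = -1 := by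
    intro p _ hp _
    have h : ((ℓ + 1 : ℕ) : ZMod p) = 0 :=
      (ZMod.natCast_eq_zero_iff _ _).mpr (hp.trans ((Dvd.intro_left _ rfl).trans hmdvd))
    rw [Nat.cast_add, Nat.cast_one] at h
    exact eq_neg_of_add_eq_zero_left h
  have hns : ¬ Wd.selmerGroup 2 ≤ MazurRubin2010.strictLocalKer Wd ℚ_[ℓ] 2 := fun hle ↦ hc'ℓ (hle hc'S)
  refine ⟨ℓ, hℓF, hℓB₀, hmdvd, hKoly, hFrobM, fun W₂ _ hW₂ ↦ ?_⟩
  obtain ⟨-, -, K₂, _, _, hK₂, hd₂, hodd₂, -, hH₂, h2K₂, -, -⟩ :=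
    GenusKolyTwin.exists_heegnerField_of_prime Wd hℓ hℓ8 hℓNd
  have hW₂' : ∃ C₂ : VariableChange ℚ, C₂ • Wd.quadraticTwist (discr K₂ : ℚ) = W₂ := by
    rw [hd₂]; push_cast; exact hW₂
  have h := GenusKolyTwistLocal.natCard_selmerGroup_eq_two_mul_of_not_le_strictLocalKer Wd hPT hEP hΔd hK₂ hodd₂ hH₂ h2K₂ hd₂
    W₂ hW₂' hns
  rw [h2] at h
  omega

/-- **THE DEPTH-`M` SUPPLY EXISTS IFF THE TWIN IS NOT ENTANGLED (class level), modulo {PT, Tate χ}.** In the frame of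
`exists_kolyvaginPrime_pow_evenTwist_selmer_eq_one_of_duality`: «some `2`-Selmer class of `Wd` does not die on `Γ_{ℚ(E[2^M])}`» ⟺ «beyond
every finite `B₀` there is a depth-`M` Kolyvagin prime `ℓ` with `8·N_W·N_{Wd} ∣ ℓ + 1` at which every elliptic model of `Wd^{(−ℓ)}` has
`#Sel₂ = 1`». ⟹ is the supply (above); ⟸ is the necessity (p627529 `two_dvd_natCard_selmerGroup_evenTwist_of_entangled`: an entangled twin's
even genus twist has EVEN `#Sel₂` at every such prime; applied to the model `Wd^{(−ℓ)}` itself at the one prime the right side yields for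
`B₀ = ∅`). [cite: MazurRubin2010, Cor. 3.4 (i), Prop. 3.3, Lemma 3.5] [cite: LawsonWuthrich2016, Lemma 6 and Thm. 1]
[cite: MilneADT2006, I Thm. 2.8, 4.10] -/
theorem exists_selmer_h1Eval_ne_iff_forall_exists_kolyvaginPrime_evenTwist_selmer_eq_one
    (hPT : poitouTate_selmerStructure_duality_real ℚ)
    (hEP : ∀ v : HeightOneSpectrum (𝓞 ℚ), localEulerPoincareCharacteristic (v.adicCompletion ℚ))
    (hsurj : W.HasSurjectiveModNGaloisRep 2) (hΔ : W.Δ < 0) (hK : IsImaginaryQuadratic K)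
    {d : ℚ} (hd : d ≠ 0) {Wd : WeierstrassCurve ℚ} [Wd.IsElliptic] [Wd.IsGloballyMinimal] {C : VariableChange ℚ}
    (hWd : C • W.quadraticTwist d = Wd) (h2 : Nat.card (Wd.selmerGroup 2) = 2) {M : ℕ} (hM : 1 ≤ M) :
    (∃ c' ∈ Wd.selmerGroup 2, ∃ h ∈ torsionFixing W ((2 ^ M : ℕ) : ℤ), h1Eval Wd (2 : ℤ) c' h ≠ 0) ↔
      ∀ B₀ : Finset ℕ, ∃ ℓ : ℕ, ∃ _ : Fact ℓ.Prime, ℓ ∉ B₀ ∧ 8 * W.conductorNorm ℤ * Wd.conductorNorm ℤ ∣ ℓ + 1 ∧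
        IsKolyvaginPrime (W.conductorNorm ℤ) W K 2 ℓ ∧ FrobEqFrobInfty W K (2 ^ M) ℓ ∧
        ∀ (W₂ : WeierstrassCurve ℚ) [W₂.IsElliptic],
          (∃ C₂ : VariableChange ℚ, C₂ • Wd.quadraticTwist (-(ℓ : ℚ)) = W₂) → Nat.card (W₂.selmerGroup 2) = 1 := by
  constructor
  · intro hS' B₀
    exact exists_kolyvaginPrime_pow_evenTwist_selmer_eq_one_of_duality W hPT hEP hsurj hΔ hK hd hWd h2 hM hS' B₀
  · intro hsupply
    by_contra hent
    push Not at hent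
    obtain ⟨ℓ, hℓF, -, hmdvd, hKoly, hFrobM, hSel⟩ := hsupply ∅
    have hℓ : ℓ.Prime := hℓF.out
    have hℓ8 : ℓ % 8 = 7 := by
      have h8 : 8 ∣ ℓ + 1 := (Dvd.intro _ rfl).trans ((Dvd.intro _ rfl).trans hmdvd)
      omega
    have hℓN : ¬ ℓ ∣ W.conductorNorm ℤ := hKoly.2.1
    have hℓNd : ∀ p : ℕ, p.Prime → p ∣ Wd.conductorNorm ℤ → p ≠ 2 → (ℓ : ZMod p) = -1 := by
      intro p _ hp _
      have h : ((ℓ + 1 : ℕ) : ZMod p) = 0 :=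
        (ZMod.natCast_eq_zero_iff _ _).mpr (hp.trans ((Dvd.intro_left _ rfl).trans hmdvd))
      rw [Nat.cast_add, Nat.cast_one] at h
      exact eq_neg_of_add_eq_zero_left h
    have hℓ0 : (-(ℓ : ℚ)) ≠ 0 := neg_ne_zero.mpr (by exact_mod_cast hℓ.ne_zero)
    haveI := Wd.isElliptic_quadraticTwist hℓ0
    have h1 := hSel (Wd.quadraticTwist (-(ℓ : ℚ))) ⟨1, one_smul _ _⟩
    exact (two_dvd_natCard_selmerGroup_evenTwist_of_entangled W hΔ hd hWd h2 hM hent hℓ8 hℓN hℓNd hFrobM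
      (Wd.quadraticTwist (-(ℓ : ℚ))) ⟨1, one_smul _ _⟩).2 h1

/-- **THE DEPTH-`M` SUPPLY EXISTS IFF THE TWIN'S GENERATOR IS NOT HALVABLE OVER `ℚ(E[2^M])` (point level), modulo {PT, Tate χ}.**
Frame as above, with `P ∈ Wd(ℚ)` NOT in `2Wd(ℚ)` (no `Γ_ℚ`-fixed half: `Q − T` is not fixed for any `T ∈ Wd[2]`) and a half `Q` (`2Q = P`):
«some `h ∈ Γ_{ℚ(E[2^M])}` MOVES `Q`» ⟺ the supply. (⟹: g8's point-level discharge `exists_selmer_h1Eval_ne_twist_of_smul_half_ne` ∘ class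
level; ⟸: class level ∘ p627529's `forall_selmer_torsionFixing_pow_h1Eval_eq_zero_of_half_fixed`, contrapositive.) At `M = 2` on WALL row 1
this is the statement «the auxiliary-field form of U (p615396) receives its prime `ℓ` with `4 ∣ a_ℓ` and its `Sel₂`-trivial even genus
twist IFF the twin's generator is not halvable over `ℚ(E[4])`» — DES13: 508/510. BSD is not proved by this.
[cite: MazurRubin2010, Cor. 3.4 (i), Remark 2.4] [cite: SilvermanAEC2009, VIII.2 (Kummer pairing)] [cite: LawsonWuthrich2016, Lemma 6 and Thm. 1] -/
theorem exists_torsionFixing_smul_ne_iff_forall_exists_kolyvaginPrime_evenTwist_selmer_eq_one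
    (hPT : poitouTate_selmerStructure_duality_real ℚ)
    (hEP : ∀ v : HeightOneSpectrum (𝓞 ℚ), localEulerPoincareCharacteristic (v.adicCompletion ℚ))
    (hsurj : W.HasSurjectiveModNGaloisRep 2) (hΔ : W.Δ < 0) (hK : IsImaginaryQuadratic K)
    {d : ℚ} (hd : d ≠ 0) {Wd : WeierstrassCurve ℚ} [Wd.IsElliptic] [Wd.IsGloballyMinimal] {C : VariableChange ℚ}
    (hWd : C • W.quadraticTwist d = Wd) (h2 : Nat.card (Wd.selmerGroup 2) = 2) {M : ℕ} (hM : 1 ≤ M)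
    (P : Wd.toAffine.Point) (Q : geomPoints Wd) (hQ : (2 : ℤ) • Q = toGeomPoints Wd P)
    (hP : ∀ T ∈ geomTorsion Wd (2 : ℤ), Q - T ∉ MulAction.fixedPoints (absoluteGaloisGroup ℚ) (geomPoints Wd)) :
    (∃ h ∈ torsionFixing W ((2 ^ M : ℕ) : ℤ), h • Q ≠ Q) ↔
      ∀ B₀ : Finset ℕ, ∃ ℓ : ℕ, ∃ _ : Fact ℓ.Prime, ℓ ∉ B₀ ∧ 8 * W.conductorNorm ℤ * Wd.conductorNorm ℤ ∣ ℓ + 1 ∧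
        IsKolyvaginPrime (W.conductorNorm ℤ) W K 2 ℓ ∧ FrobEqFrobInfty W K (2 ^ M) ℓ ∧
        ∀ (W₂ : WeierstrassCurve ℚ) [W₂.IsElliptic],
          (∃ C₂ : VariableChange ℚ, C₂ • Wd.quadraticTwist (-(ℓ : ℚ)) = W₂) → Nat.card (W₂.selmerGroup 2) = 1 := by
  have h2M : (2 : ℤ) ∣ ((2 ^ M : ℕ) : ℤ) := by
    rw [Nat.cast_pow, Nat.cast_ofNat]; exact dvd_pow_self 2 (by omega : M ≠ 0)
  rw [← exists_selmer_h1Eval_ne_iff_forall_exists_kolyvaginPrime_evenTwist_selmer_eq_one W hPT hEP hsurj hΔ hK hd hWd h2 hM]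
  constructor
  · intro hmove
    exact exists_selmer_h1Eval_ne_twist_of_smul_half_ne W hd hWd h2M P Q hQ hmove
  · rintro ⟨c', hc'S, h, hh, hc'⟩
    by_contra hfix
    push Not at hfix
    exact hc' (forall_selmer_torsionFixing_pow_h1Eval_eq_zero_of_half_fixed W hd hWd h2 hM P Q hQ hP hfix c' hc'S h hh)

end DepthIff

end Summit.BirchSwinnertonDyer.BirchSwinnertonDyer.Theorems.GenusKolyTwistingPrime

end
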